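import Summits.QuantumAdvantage.QuantumAdvantage.Theses.SosSandwich
import Literature.Computability.MetaComplexity.HeuristicClasses

/-!
# Route `SosSandwich`, crux `RandomOracleHeurSeparation` (stmt-QuantumAdvantage-1131): vocabulary of the line `birth`

`Defs` file (D-0016 `<Route>Defs` convention; precedent
`Summits/AnomalousDissipation/AnomalousDissipation/Theorems/DecimationAxisUniformEquilibrationDefs.lean`) of
the crux skeleton `Summits/QuantumAdvantage/QuantumAdvantage/Cruxes/RandomOracleHeurSeparation/Lines/birth.lean`
(sha c85efc9e6d948963…, registrar planner-skel-stmt-QuantumAdvantage-1131-0; registered stubs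
`stub_almostAvgP_heur : ∀ L : Language Bool, L ∈ almostAvgP → HeurConstBPP L` and
`stub_liouville_heurHard : ∃ δ : ℝ, 0 < δ ∧ (⟨liouvilleLang, uniformEnsemble⟩ : DistProblem) ∉ HeurDeltaBPP (fun _ => δ)`).
A `Cruxes/…/Lines/*.lean` skeleton is not an importable module, so the VOCABULARY the registered stub
signatures are written in lives here — copied VERBATIM from the skeleton (same namespace
`Summit.QuantumAdvantage.QuantumAdvantage.Cruxes.RandomOracleHeurSeparation.Birth`, same names) — to be
imported by the stub files `Theorems/SosSandwichRandomOracleHeurSeparationStub<Name>.lean` (landed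
`--supports stmt-QuantumAdvantage-1131`) and by the closing composition; the skeleton is re-pointed by
importing this module and deleting its local copies (zero renaming).

Nothing open is asserted: three plain definitions (a language, a class of languages, a class predicate),
no theorem. The skeleton's import of `Theorems.MobiusLadderLiouvilleMemBQP` (used only by the composition,
for `LiouvilleMemBQP_proof`) is not needed by the vocabulary and is not repeated here.

Contents (verbatim from the skeleton):
* `liouvilleLang` — the Liouville language `L_λ = {bin(N) : λ(N) = −1}` (the object of stub 2);
* `almostAvgP` — ALMOST-`AvgP`: the languages in Aaronson–Ambainis' heuristic class `AvgP^A`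
  (`Complexity.AvgPRel`) for almost every oracle `A` under the fact-free random-oracle law `randomOracle`;
* `HeurConstBPP L` — `(L, U) ∈ Heur_δBPP` for every constant `δ > 0` (Bogdanov–Trevisan's `HeurDeltaBPP`
  on the uniform ensemble `uniformEnsemble`).
Sources: BookVollmerWagner1996 §1 (ALMOST-classes); AaronsonAmbainis2014 §1 p. 5 and Thm. 7 (iii) (AvgP);
BogdanovTrevisan2006 Def. 2.13 (Heur_δBPP); Shor1997 §5.
-/

-- D-0017: single-conjunct summit ⇒ the duplicate `QuantumAdvantage.QuantumAdvantage` is mandated.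
set_option linter.dupNamespace false

noncomputable section

namespace Summit.QuantumAdvantage.QuantumAdvantage.Cruxes.RandomOracleHeurSeparation.Birth

open MeasureTheory Filter
open Literature.Computability.Complexity (AvgPRel Oracle BPP)
open Literature.Computability.Cryptography (BQP BQPRel BQP_subset_BQPRel)
open Literature.Computability.QuantumComplexity (randomOracle)
open Literature.Computability.MetaComplexity (HeurDeltaBPP uniformEnsemble DistProblem)

/-- **The Liouville language** `L_λ = {bin(N) : λ(N) = −1}` (canonical LSB-first numerals of the
`N` with `Ω(N)` odd) — literally the language of route MobiusLadder's items (`LiouvilleMemBQP`,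
`LiouvilleNotPPoly`), so that the tree theorem `LiouvilleMemBQP_proof : L_λ ∈ BQP` applies by `rfl`.
Verbatim the skeleton's `liouvilleLang`. [cite: Shor1997, §5 (λ is read off the factorisation)] -/
def liouvilleLang : Language Bool :=
  Computability.encodingNatBool.toLanguage {N : ℕ | ArithmeticFunction.liouville N = -1}

/-- **ALMOST-`AvgP`**: the languages that are in Aaronson–Ambainis' heuristic class `AvgP^A`
(`Complexity.AvgPRel`: one polynomial-time transcript machine with oracle `A`, error fraction `→ 0`)
for almost every oracle `A` under the random-oracle law `randomOracle` — the `AvgP` analogue of the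
tree's `Complexity.almostP` (ALMOST-`P`, Book–Vollmer–Wagner). Verbatim the skeleton's `almostAvgP`.
[cite: BookVollmerWagner1996, §1 (ALMOST-classes)] [cite: AaronsonAmbainis2014, §1 (p. 5, AvgP) and Thm. 7 (iii)] -/
def almostAvgP : Set (Language Bool) :=
  {L | ∀ᵐ (A : Set (List Bool)) ∂randomOracle, L ∈ AvgPRel (Oracle.ofLanguage A)}

/-- **Heuristically `BPP` with every constant failure rate, on the uniform ensemble**:
`HeurConstBPP L` iff for every constant `δ > 0` the distributional problem `(L, U)` (`U_n` uniform on
`{0,1}ⁿ`, tree `uniformEnsemble`) is in Bogdanov–Trevisan's `Heur_δBPP` (tree `HeurDeltaBPP (fun _ => δ)`: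
a probabilistic polynomial-time `A(x, 1ⁿ)` with
`Pr_{x ∼ U_n}[Pr_coins[A(x,1ⁿ) ≠ [x ∈ L]] ≥ 1/4] ≤ δ` for EVERY `n`), i.e. `(L, U) ∈ ⋂_{δ>0} Heur_δBPP`.
The algorithm may depend on `δ`. Verbatim the skeleton's `HeurConstBPP`.
[cite: BogdanovTrevisan2006, Def. 2.13 (Heur_δBPP)] -/
def HeurConstBPP (L : Language Bool) : Prop :=
  ∀ δ : ℝ, 0 < δ → (⟨L, uniformEnsemble⟩ : DistProblem) ∈ HeurDeltaBPP (fun _ => δ)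

end Summit.QuantumAdvantage.QuantumAdvantage.Cruxes.RandomOracleHeurSeparation.Birth

end
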